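import Literature.NumberTheory.EllipticCurves.OggFormulaTameTypesTwoProofs
import Literature.NumberTheory.EllipticCurves.QuadraticTwistTameTorsionSwanProofs
import Literature.NumberTheory.EllipticCurves.QuadraticTwistJInvariantProofs
import Literature.NumberTheory.EllipticCurves.NeronComponentIndexProofs
import Literature.NumberTheory.EllipticCurves.CongruentNumberCurveMinimalAtTwo
import Literature.NumberTheory.EllipticCurves.LocalReductionKrausTwo
import HarnessLib

/-!
# Ogg's formula at `2` over `ℚ` for the quadratic twists of the tame curves (`Φ = C₆`), and the
# `C₆`-branch of Kodaira type `II` with `ord₂ Δ_min = 4`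

`Proofs` file (theorems only, no definitions, no named facts, no instances) in topic
`NumberTheory/EllipticCurves`, sequel of `OggFormulaTameTypesTwoProofs` (same seat: the C15 fact
`WeierstrassCurve.conductorNatOf_geomPoints_eq_conductorNorm_of_isElliptic W ℓ`, `HasseWeilAbelian`;
Serre–Tate 1968 §3, Silverman *ATAEC* §IV.10 and Ogg's formula IV.11.1).

## Context

The leaf of Ogg–Saito left over `ℚ` (`HasseWeilAbelianConductorNatOfPotGoodTwoProofs`,
`OggFormulaPotGoodOrdinaryTwoProofs`) is the statement `Sw_𝔓(E[3]) = δ₂(E)` for the elliptic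
curves `E/ℚ` additive at `2` with `ord₂(j) > 0`; there the inertia group acts on `E[3]` through
`Φ ≤ Aut(Ẽ) ≅ SL₂(𝔽₃)`, `|Φ| ∈ {2, 3, 4, 6, 8, 24}`.  `OggFormulaTameTypesTwoProofs` did
`Φ = C₃` (Kodaira types `IV`, `IV*`: good reduction over `ℚ₂(∛2)`).  This file does the
**twists of those curves by a ramified quadratic character** — `Φ = C₆ = C₃ × C₂` — on the
Galois side in general, and on the discriminant side for the first Tate branch in which they
occur, type `II` with `ord₂ Δ_min = 4`.

## The argument

* **Galois side** (§1; Silverman *ATAEC* Thm. IV.10.2(b), twist mechanism, with the tame case).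
  If the quadratic twist `E^{(d)}` (`d ∈ ℤ ∖ 0`) acquires good reduction above `2` over the
  number fields containing a cube root of `2`, then every wild ramification group `Γ_ℚ^u(𝔓)`
  (`u > 0`, `𝔓 ∣ 2`) fixes `E^{(d)}[ℓ]` (`ℓ` odd; the Kummer argument of
  `OggFormulaTameTypesTwoProofs`, here as
  `forall_smul_geomTorsion_eq_of_hasGoodReductionAt_baseChange_of_pow_three_eq_two`), hence fixes
  `E[ℓ]` iff it fixes `√d`
  (`forall_smul_geomTorsion_eq_iff_le_stabilizer_of_forall_smul_geomTorsion_quadraticTwist_eq`,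
  `QuadraticTwistTameTorsionSwanProofs`), and
  `Sw_𝔓(V_ℓ E) = 2 · vol {u > 0 : Γ^u moves √d} = 2, 4, 0` for `d ≡ 3, 2, 1 (mod 4)`
  (`SqrtUpperRamificationProofs`): `δ(E) = 2δ(χ_d)`.
* **Discriminant side for type `II`, `ord₂ Δ_min = 4`** (§§2–4; *ATAEC* IV.9.4 Step 3 with
  `π = 2`).  A minimal equation of type `II` at `2` with `ord₂ Δ = 4` has a `ℤ₂`-model
  `y² + 2αxy + 2γy = x³ + a₂x² + 2qx + 2r` with `γ, r ∈ ℤ₂^×`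
  (`exists_smul_a_of_kodairaSymbolOfMinimal_eq_II_of_two_of_addVal_eq_four`: `a₃/2` is a unit
  because otherwise `2⁶ ∣ Δ`), whose `b₈ = 4(2α²r + 2a₂r - 2αγq + a₂γ² - q²)` lies in `8ℤ₂` iff
  `a₂ ≡ q (mod 2)`.  **In that case** the twist by `-1`,
  `y² = x³ - (α² + a₂)x² + 2(q + αγ)x - (γ² + 2r)`, after `y ↦ y + sx + 1` (`s ∈ {0, 1}` the
  parity of `α² + a₂`) has `2 ∣ a₁, a₂`, `a₃ = 2`, `4 ∣ a₄, a₆`, `ord₂ Δ = 4` — the shape of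
  type `IV` (`exists_variableChange_quadraticTwist_neg_one_of_II_four_of_valuation_b₈_le`; the
  `2`-adic congruences `γ² ≡ 1 (mod 8)`, `x ≡ x² (mod 2)` of `CongruentNumberCurveMinimalAtTwo`) —
  so `E^{(-1)}` acquires good reduction over `ℚ(∛2)`
  (`hasGoodReductionAt_baseChange_of_pow_three_eq`, `OggFormulaTameTypesTwoProofs`), and
  `Sw_𝔓(V_ℓ E) = 2 · 1 = 2 = ord₂ Δ_min - 2 = δ₂(E)`.  (In the other case, `b₈ ∈ 4ℤ₂^×`, the
  twist by `-1` is of type `III` and `Φ = SL₂(𝔽₃)`; that branch is not treated here.)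

## Main results

* `WeierstrassCurve.forall_smul_geomTorsion_eq_of_hasGoodReductionAt_baseChange_of_pow_three_eq_two`,
  `WeierstrassCurve.swanConductorAt_rationalTate_eq_two_mul_volume_sqrt_of_quadraticTwist`,
  `…_eq_two / _eq_four / _eq_zero_of_quadraticTwist_of_emod_four_eq_three / _two / _one` — the
  Galois side for every `W/ℚ` whose twist `W^{(d)}` has potential good reduction over `ℚ(∛2)`;
* `WeierstrassCurve.exists_variableChange_valuation_a_b₈_of_two` — Tate's normal forms at an
  absolutely unramified place above `2` made `K`-rational, with the shapes of `a₁, …, a₆, b₈, Δ`;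
* `WeierstrassCurve.exists_variableChange_of_kodairaSymbolAt_II_of_ordMinimalDiscriminant_eq_four`
  — over `ℚ`: the normal form of type `II`, `ord₂ Δ_min = 4`, with the dichotomy `8 ∣ b₈` /
  `b₈ ∈ 4ℤ₂^×`;
* `WeierstrassCurve.swanConductorAt_rationalTate_eq_two_of_II_four_of_valuation_b₈_le`,
  `WeierstrassCurve.swanConductorAt_torsion_eq_wildConductorExponent_of_II_four_of_valuation_b₈_le`
  — **Ogg's formula at `2` for the `C₆`-curves of type `II`, `ord₂ Δ_min = 4`**:
  `Sw_𝔓(V_ℓ E) = 2` and `Sw_𝔓(E[3]) = δ₂(E) = 2`.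

No definitions, no named facts (D-0026).  All axioms `propext`, `Classical.choice`, `Quot.sound`.

## References

* J. H. Silverman, *Advanced Topics in the Arithmetic of Elliptic Curves*, GTM 151 (1994), IV.9.4
  (Tate's algorithm, Step 3) and Table 4.1; §IV.10 (Definition of `ε, δ, f`, PDF p. 358;
  Thm. 10.2(b) and its proof, pp. 359–362); §IV.11 (Ogg's formula 11.1, p. 365; the case `p = 2`,
  p. 366). [SilvermanATAEC1994]
* J. H. Silverman, *The Arithmetic of Elliptic Curves*, 2nd ed. (2009), VII.1 Remark 1.1,
  VII.4.1(a), VII.5 Prop. 5.1 and Prop. 5.4, X.5 Cor. 5.4 (quadratic twists). [SilvermanAEC2009]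
* J.-P. Serre, J. Tate, *Good reduction of abelian varieties*, Ann. of Math. 88 (1968), §§2–3.
  [SerreTate1968]
* J.-P. Serre, *Local Fields*, GTM 67 (1979), Ch. IV §§1–3, Ch. VI §2. [SerreLocalFields1979]
* T. Saito, *Conductor, discriminant, and the Noether formula of arithmetic surfaces*, Duke Math.
  J. 57 (1988), Theorem 1 (cited only). [Saito1988]

## Design

Theorems only; `noncomputable section`.  §1 and §§3–4 over `ℚ` in `namespace WeierstrassCurve`
(the hypothesis "good reduction above `2` over every number field `L ∋ β`, `β³ = 2`" is stated for
`L : Type`, the universe of `ℚ`, as required by `smul_eq_of_mem_inertia_of_baseChange_of_nsmul_eq_zero`);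
§2 at the DVR level in `namespace Literature.NumberTheory.EllipticCurves.LocalIndex` and at places
of Dedekind domains in `namespace WeierstrassCurve`, with the signatures of
`OggFormulaTameTypesTwoProofs`.  Axioms: `propext`, `Classical.choice`, `Quot.sound`.
-/

noncomputable section

open scoped Classical NumberField Polynomial IntermediateField
open NumberField IsDedekindDomain Field Polynomial WithZero

universe u

/-! ## §1. The Galois side: twists of curves that are potentially good over `ℚ(∛2)` -/

namespace WeierstrassCurve

open Literature.NumberTheory.EllipticCurves Literature.NumberTheory.GaloisRepresentations
  IsDedekindDomain.HeightOneSpectrum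

variable (W : WeierstrassCurve ℚ)

/-- **The wild ramification groups above `2` fix `E[ℓ]` when `E` acquires good reduction over the
fields containing `∛2`.**  Let `W/ℚ` be elliptic, `v ∋ 2`, and suppose that for every number field
`L` and every `β ∈ L` with `β³ = 2`, `E` has good reduction at the places of `L` above `v`.  Then
for `u > 0`, `𝔓 ∣ v` and `ℓ ∉ v`, every `σ ∈ Γ_ℚ^u(𝔓)` fixes `E[ℓ]` pointwise: with `β ∈ ℚ̄`,
`β³ = 2`, `L = ℚ(β) = ℚ[β]`, `σ` fixes the cube roots of `2`
(`smul_eq_of_mem_absUpperRamificationSubgroup_of_pow_three_eq`), hence `e(L)` pointwise for the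
embedding `e` of `exists_mem_range_absGaloisRestrict_iff`, so it lies in the image of `Γ_L` and in
`I_𝔓`, and *AEC* VII.4.1(a) over `L` applies
(`smul_eq_of_mem_inertia_of_baseChange_of_nsmul_eq_zero`).  This is the mechanism of
`forall_smul_geomTorsion_eq_of_kodairaSymbolAt_IV_or_IVstar_two` (`OggFormulaTameTypesTwoProofs`)
with the good reduction as a hypothesis.
[cite: SilvermanATAEC1994, proof of Thm. IV.10.2(b) (PDF pp. 359–361)]
[cite: SilvermanAEC2009, Prop. VII.4.1(a)] [cite: SerreLocalFields1979, Ch. IV §2 Cor. 1–3 of Prop. 7] -/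
theorem forall_smul_geomTorsion_eq_of_hasGoodReductionAt_baseChange_of_pow_three_eq_two
    [W.IsElliptic] {v : HeightOneSpectrum (𝓞 ℚ)} (hv : (2 : 𝓞 ℚ) ∈ v.asIdeal)
    (hgood : ∀ (L : Type) [Field L] [NumberField L] [Algebra ℚ L] (β : L), β ^ 3 = 2 →
      ∀ w : HeightOneSpectrum (𝓞 L), w.asIdeal.under (𝓞 ℚ) = v.asIdeal →
        (W.baseChange L).HasGoodReductionAt w)
    {ℓ : ℕ} (hℓ : (ℓ : 𝓞 ℚ) ∉ v.asIdeal)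
    {𝔓 : Ideal (absIntegers (𝓞 ℚ) ℚ)} (h𝔓 : 𝔓 ∈ v.primesAbove) {u : ℝ} (hu : 0 < u) :
    ∀ σ ∈ absUpperRamificationSubgroup (𝓞 ℚ) 𝔓 u, ∀ T : geomTorsion W ℓ, σ • T = T := by
  intro σ hσ T
  -- `β ∈ ℚ̄` with `β³ = 2`, and `L = ℚ(β)`
  obtain ⟨β, hβ⟩ : ∃ β : AlgebraicClosure ℚ, β ^ 3 = algebraMap ℚ (AlgebraicClosure ℚ) 2 :=
    IsAlgClosed.exists_pow_nat_eq _ three_pos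
  have hβint : _root_.IsIntegral ℚ β := ⟨X ^ 3 - C 2, monic_X_pow_sub_C _ three_ne_zero, by simp [hβ]⟩
  set L : IntermediateField ℚ (AlgebraicClosure ℚ) := ℚ⟮β⟯ with hL
  haveI : FiniteDimensional ℚ L := IntermediateField.adjoin.finiteDimensional hβint
  haveI : NumberField L := NumberField.of_module_finite ℚ L
  set βL : L := ⟨β, IntermediateField.mem_adjoin_simple_self ℚ β⟩ with hβL_def
  have hβL : βL ^ 3 = 2 := by
    apply Subtype.ext
    simp only [hβL_def, SubmonoidClass.mk_pow, hβ]
    exact (map_ofNat (algebraMap L (AlgebraicClosure ℚ)) 2).symm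
  -- `σ` lies in the image of `Γ_L`: it fixes `e(L) = ℚ(e β)`
  obtain ⟨e, he⟩ := exists_mem_range_absGaloisRestrict_iff ℚ L
  have heβ : (e βL) ^ 3 = algebraMap ℚ (AlgebraicClosure ℚ) 2 := by
    rw [← map_pow, hβL, map_ofNat, map_ofNat]
  have hσe : σ • e βL = e βL :=
    smul_eq_of_mem_absUpperRamificationSubgroup_of_pow_three_eq hv h𝔓 hu hσ two_ne_zero heβ
  have hσL : σ ∈ (absGaloisRestrict ℚ L).range := by
    rw [he]
    intro x
    have hx : (x : AlgebraicClosure ℚ) ∈ (ℚ⟮β⟯).toSubalgebra := x.2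
    rw [IntermediateField.adjoin_simple_toSubalgebra_of_isAlgebraic hβint.isAlgebraic,
      Algebra.adjoin_singleton_eq_range_aeval] at hx
    obtain ⟨p, hp⟩ := hx
    have hx' : x = aeval βL p := by
      apply Subtype.ext
      have h1 : ((aeval βL p : L) : AlgebraicClosure ℚ) = aeval β p :=
        (aeval_algHom_apply (IntermediateField.val L) βL p).symm
      rw [h1]
      exact hp.symm
    have h1 : e (aeval βL p) = p.eval₂ (algebraMap ℚ (AlgebraicClosure ℚ)) (e βL) := by
      rw [aeval_def]
      have h := hom_eval₂ p (algebraMap ℚ L) (e : L →+* AlgebraicClosure ℚ) βL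
      rw [RingHom.ext_rat ((e : L →+* AlgebraicClosure ℚ).comp (algebraMap ℚ L))
        (algebraMap ℚ (AlgebraicClosure ℚ))] at h
      exact h
    set τ : AlgebraicClosure ℚ →+* AlgebraicClosure ℚ :=
      ((absoluteGaloisGroup.toAlgEquiv ℚ σ : AlgebraicClosure ℚ ≃ₐ[ℚ] AlgebraicClosure ℚ) :
        AlgebraicClosure ℚ →+* AlgebraicClosure ℚ) with hτ
    have hτapp : ∀ y : AlgebraicClosure ℚ, σ • y = τ y := fun y ↦ by
      rw [absoluteGaloisGroup.smul_def, hτ]; rfl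
    have h2 := hom_eval₂ p (algebraMap ℚ (AlgebraicClosure ℚ)) τ (e βL)
    rw [RingHom.ext_rat (τ.comp (algebraMap ℚ (AlgebraicClosure ℚ)))
      (algebraMap ℚ (AlgebraicClosure ℚ)), ← hτapp, ← hτapp, hσe] at h2
    rw [hx', h1, h2]
  -- `σ ∈ I_𝔓` fixes the `ℓ`-torsion
  have hσI : σ ∈ 𝔓.inertia (absoluteGaloisGroup ℚ) :=
    absUpperRamificationSubgroup_le_inertia_holds (𝓞 ℚ) 𝔓 u hσ
  have hT0 : ℓ • (T : geomPoints W) = 0 := by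
    have := (W.mem_geomTorsion_iff ℓ (T : geomPoints W)).mp T.2
    rwa [natCast_zsmul] at this
  exact Subtype.ext (W.smul_eq_of_mem_inertia_of_baseChange_of_nsmul_eq_zero L
    (hgood L βL hβL) hℓ h𝔓 hσI hσL hT0)

variable (ℓ : ℕ) [Fact ℓ.Prime]

/-- **The wild conductor of a curve whose quadratic twist is potentially good over `ℚ(∛2)`.**
For an elliptic `W/ℚ`, `v ∋ 2`, a prime `ℓ ∉ v`, `d ∈ ℤ ∖ 0` such that `W^{(d)}` has good
reduction above `v` over every number field containing a cube root of `2`, and `𝔓 ∣ v`: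
`Sw_𝔓(V_ℓ E) = 2 · vol {u > 0 : some σ ∈ Γ_ℚ^u(𝔓) moves √d}`.  The wild ramification groups
fix `W^{(d)}[ℓ]`
(`forall_smul_geomTorsion_eq_of_hasGoodReductionAt_baseChange_of_pow_three_eq_two`), so they fix
`W[ℓ]` iff they fix `√d`
(`swanConductorAt_rationalTate_eq_two_mul_volume_smul_geomSqrt_ne_of_forall_smul_geomTorsion_quadraticTwist_eq`,
`QuadraticTwistTameTorsionSwanProofs`): `δ(E) = 2δ(χ_d)` for `E = E₀ ⊗ χ_d` with `E₀` tame,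
Silverman *ATAEC* Thm. IV.10.2(b).
[cite: SilvermanATAEC1994, Thm. IV.10.2(b),(c) and proof (PDF pp. 358–362)]
[cite: SilvermanAEC2009, X.5 Cor. 5.4] -/
theorem swanConductorAt_rationalTate_eq_two_mul_volume_sqrt_of_quadraticTwist
    [W.IsElliptic]
    (h : Continuous fun x : absoluteGaloisGroup ℚ × RationalTateModule (geomPoints W) ℓ ↦
      rationalTateRepresentation (absoluteGaloisGroup ℚ) (geomPoints W) ℓ x.1 x.2)
    {v : HeightOneSpectrum (𝓞 ℚ)} (hv : (2 : 𝓞 ℚ) ∈ v.asIdeal) (hℓ : (ℓ : 𝓞 ℚ) ∉ v.asIdeal)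
    {d : ℤ} (hd : d ≠ 0)
    (hgood : ∀ (L : Type) [Field L] [NumberField L] [Algebra ℚ L] (β : L), β ^ 3 = 2 →
      ∀ w : HeightOneSpectrum (𝓞 L), w.asIdeal.under (𝓞 ℚ) = v.asIdeal →
        ((W.quadraticTwist (d : ℚ)).baseChange L).HasGoodReductionAt w)
    {𝔓 : Ideal (absIntegers (𝓞 ℚ) ℚ)} (h𝔓 : 𝔓 ∈ v.primesAbove) :
    (rationalTateGaloisRepOf (geomPoints W) ℓ h).swanConductorAt (𝓞 ℚ) 𝔓 =
      2 * MeasureTheory.volume.real {u : ℝ | 0 < u ∧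
        ∃ σ ∈ absUpperRamificationSubgroup (𝓞 ℚ) 𝔓 u, σ • geomSqrt (d : ℚ) ≠ geomSqrt (d : ℚ)} := by
  have hd' : (d : ℚ) ≠ 0 := by exact_mod_cast hd
  haveI : (W.quadraticTwist (d : ℚ)).IsElliptic := W.isElliptic_quadraticTwist hd'
  have hℓ2 : ℓ ≠ 2 := by
    rintro rfl
    exact hℓ (by simpa using hv)
  exact W.swanConductorAt_rationalTate_eq_two_mul_volume_smul_geomSqrt_ne_of_forall_smul_geomTorsion_quadraticTwist_eq
    ℓ h hℓ hℓ2 hd' h𝔓 fun u hu ↦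
      (W.quadraticTwist (d : ℚ)).forall_smul_geomTorsion_eq_of_hasGoodReductionAt_baseChange_of_pow_three_eq_two
        hv (hgood) hℓ h𝔓 hu

/-- **`Sw_𝔓(V_ℓ E) = 2` when `W^{(d)}`, `d ≡ 3 (mod 4)`, is potentially good over `ℚ(∛2)`**
(the break of `ℚ₂(√d)` is `1`, `Rat.volume_real_setOf_smul_sqrt_ne_of_emod_four_eq_three`).
[cite: SilvermanATAEC1994, Thm. IV.10.2(b) and proof (PDF pp. 359–362)]
[cite: SerreLocalFields1979, Ch. IV §1 Prop. 2 ff., §3 Prop. 14] -/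
theorem swanConductorAt_rationalTate_eq_two_of_quadraticTwist_of_emod_four_eq_three
    [W.IsElliptic]
    (h : Continuous fun x : absoluteGaloisGroup ℚ × RationalTateModule (geomPoints W) ℓ ↦
      rationalTateRepresentation (absoluteGaloisGroup ℚ) (geomPoints W) ℓ x.1 x.2)
    {v : HeightOneSpectrum (𝓞 ℚ)} (hv : (2 : 𝓞 ℚ) ∈ v.asIdeal) (hℓ : (ℓ : 𝓞 ℚ) ∉ v.asIdeal)
    {d : ℤ} (hd : d % 4 = 3)
    (hgood : ∀ (L : Type) [Field L] [NumberField L] [Algebra ℚ L] (β : L), β ^ 3 = 2 →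
      ∀ w : HeightOneSpectrum (𝓞 L), w.asIdeal.under (𝓞 ℚ) = v.asIdeal →
        ((W.quadraticTwist (d : ℚ)).baseChange L).HasGoodReductionAt w)
    {𝔓 : Ideal (absIntegers (𝓞 ℚ) ℚ)} (h𝔓 : 𝔓 ∈ v.primesAbove) :
    (rationalTateGaloisRepOf (geomPoints W) ℓ h).swanConductorAt (𝓞 ℚ) 𝔓 = 2 := by
  have hd0 : d ≠ 0 := by rintro rfl; simp at hd
  rw [W.swanConductorAt_rationalTate_eq_two_mul_volume_sqrt_of_quadraticTwist ℓ h hv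
    hℓ hd0 hgood h𝔓, Rat.volume_real_setOf_smul_sqrt_ne_of_emod_four_eq_three hd
    (geomSqrt_sq (d : ℚ)) hv h𝔓, mul_one]

/-- **`Sw_𝔓(V_ℓ E) = 4` when `W^{(d)}`, `d ≡ 2 (mod 4)`, is potentially good over `ℚ(∛2)`**
(the break of `ℚ₂(√d)` is `2`, `Rat.volume_real_setOf_smul_sqrt_ne_of_emod_four_eq_two`).
[cite: SilvermanATAEC1994, Thm. IV.10.2(b) and proof (PDF pp. 359–362)]
[cite: SerreLocalFields1979, Ch. IV §1 Prop. 2 ff., §3 Prop. 14] -/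
theorem swanConductorAt_rationalTate_eq_four_of_quadraticTwist_of_emod_four_eq_two
    [W.IsElliptic]
    (h : Continuous fun x : absoluteGaloisGroup ℚ × RationalTateModule (geomPoints W) ℓ ↦
      rationalTateRepresentation (absoluteGaloisGroup ℚ) (geomPoints W) ℓ x.1 x.2)
    {v : HeightOneSpectrum (𝓞 ℚ)} (hv : (2 : 𝓞 ℚ) ∈ v.asIdeal) (hℓ : (ℓ : 𝓞 ℚ) ∉ v.asIdeal)
    {d : ℤ} (hd : d % 4 = 2)
    (hgood : ∀ (L : Type) [Field L] [NumberField L] [Algebra ℚ L] (β : L), β ^ 3 = 2 →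
      ∀ w : HeightOneSpectrum (𝓞 L), w.asIdeal.under (𝓞 ℚ) = v.asIdeal →
        ((W.quadraticTwist (d : ℚ)).baseChange L).HasGoodReductionAt w)
    {𝔓 : Ideal (absIntegers (𝓞 ℚ) ℚ)} (h𝔓 : 𝔓 ∈ v.primesAbove) :
    (rationalTateGaloisRepOf (geomPoints W) ℓ h).swanConductorAt (𝓞 ℚ) 𝔓 = 4 := by
  have hd0 : d ≠ 0 := by rintro rfl; simp at hd
  rw [W.swanConductorAt_rationalTate_eq_two_mul_volume_sqrt_of_quadraticTwist ℓ h hv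
    hℓ hd0 hgood h𝔓, Rat.volume_real_setOf_smul_sqrt_ne_of_emod_four_eq_two hd
    (geomSqrt_sq (d : ℚ)) hv h𝔓]
  norm_num

/-- **`Sw_𝔓(V_ℓ E) = 0` when `W^{(d)}`, `d ≡ 1 (mod 4)`, is potentially good over `ℚ(∛2)`**
(`ℚ(√d)` is unramified at `2`: `Rat.volume_real_setOf_smul_sqrt_ne_of_emod_four_eq_one`).
[cite: SilvermanATAEC1994, Thm. IV.10.2(b) and proof (PDF pp. 359–362)] -/
theorem swanConductorAt_rationalTate_eq_zero_of_quadraticTwist_of_emod_four_eq_one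
    [W.IsElliptic]
    (h : Continuous fun x : absoluteGaloisGroup ℚ × RationalTateModule (geomPoints W) ℓ ↦
      rationalTateRepresentation (absoluteGaloisGroup ℚ) (geomPoints W) ℓ x.1 x.2)
    {v : HeightOneSpectrum (𝓞 ℚ)} (hv : (2 : 𝓞 ℚ) ∈ v.asIdeal) (hℓ : (ℓ : 𝓞 ℚ) ∉ v.asIdeal)
    {d : ℤ} (hd : d % 4 = 1)
    (hgood : ∀ (L : Type) [Field L] [NumberField L] [Algebra ℚ L] (β : L), β ^ 3 = 2 →
      ∀ w : HeightOneSpectrum (𝓞 L), w.asIdeal.under (𝓞 ℚ) = v.asIdeal →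
        ((W.quadraticTwist (d : ℚ)).baseChange L).HasGoodReductionAt w)
    {𝔓 : Ideal (absIntegers (𝓞 ℚ) ℚ)} (h𝔓 : 𝔓 ∈ v.primesAbove) :
    (rationalTateGaloisRepOf (geomPoints W) ℓ h).swanConductorAt (𝓞 ℚ) 𝔓 = 0 := by
  have hd0 : d ≠ 0 := by rintro rfl; simp at hd
  rw [W.swanConductorAt_rationalTate_eq_two_mul_volume_sqrt_of_quadraticTwist ℓ h hv
    hℓ hd0 hgood h𝔓, Rat.volume_real_setOf_smul_sqrt_ne_of_emod_four_eq_one hd hv h𝔓, mul_zero]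

end WeierstrassCurve

/-! ## §2. The discriminant side: type `II` with `ord Δ = 4` when `2` is a uniformiser -/

section DVR

open IsLocalRing
open IsDiscreteValuationRing hiding maximalIdeal

namespace Literature.NumberTheory.EllipticCurves

namespace LocalIndex

open Literature.NumberTheory.DiophantineGeometry Literature.NumberTheory.DiophantineGeometry.TateAlgorithm
  Literature.NumberTheory.DiophantineGeometry.TateAlgorithm.CharTwo

variable {R : Type*} [CommRing R] [IsDomain R] [IsDiscreteValuationRing R]

omit [IsDomain R] [IsDiscreteValuationRing R] in
/-- **On a Step-3 model with `4 ∣ a₃`, `2⁶ ∣ Δ`** (`2` a uniformiser): with `a₁ = 2α`,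
`a₃ = 4γ₁`, `a₄ = 2q`, `a₆ = 2r`, `Δ = 2⁶((r + (α² + a₂)q)² + 2J)` (the identity of
`CharTwo.addVal_Δ_toNat_le_seven_of_step3`). [folklore] -/
theorem two_pow_six_dvd_Δ_of_step3_of_four_dvd_a₃ (W : WeierstrassCurve R)
    (ha₁ : 2 ∣ W.a₁) (ha₃ : 2 ^ 2 ∣ W.a₃) (ha₄ : 2 ∣ W.a₄) (ha₆ : 2 ∣ W.a₆) :
    (2 : R) ^ 6 ∣ W.Δ := by
  obtain ⟨α, hα⟩ := ha₁
  obtain ⟨γ₁, hγ₁⟩ := ha₃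
  obtain ⟨q, hq⟩ := ha₄
  obtain ⟨r, hr⟩ := ha₆
  refine ⟨(r + (α ^ 2 + W.a₂) * q) ^ 2 + 2 *
      (-α ^ 6 * r + 2 * α ^ 5 * q * γ₁ - 3 * α ^ 4 * W.a₂ * r - 2 * α ^ 4 * W.a₂ * γ₁ ^ 2
       + 4 * α ^ 3 * W.a₂ * q * γ₁ + 18 * α ^ 3 * r * γ₁ + 4 * α ^ 3 * γ₁ ^ 3
       - 3 * α ^ 2 * W.a₂ ^ 2 * r - 4 * α ^ 2 * W.a₂ ^ 2 * γ₁ ^ 2 + 8 * α ^ 2 * q * r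
       - 30 * α ^ 2 * q * γ₁ ^ 2 + 2 * α * W.a₂ ^ 2 * q * γ₁ + 18 * α * W.a₂ * r * γ₁
       + 36 * α * W.a₂ * γ₁ ^ 3 - 24 * α * q ^ 2 * γ₁ - W.a₂ ^ 3 * r - 2 * W.a₂ ^ 3 * γ₁ ^ 2
       + 8 * W.a₂ * q * r + 18 * W.a₂ * q * γ₁ ^ 2 - 4 * q ^ 3 - 14 * r ^ 2
       - 54 * r * γ₁ ^ 2 - 54 * γ₁ ^ 4), ?_⟩
  have hγ : W.a₃ = 2 * (2 * γ₁) := by rw [hγ₁]; ring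
  simp only [WeierstrassCurve.Δ, WeierstrassCurve.b₂, WeierstrassCurve.b₄,
    WeierstrassCurve.b₆, WeierstrassCurve.b₈, hα, hγ, hq, hr]
  ring

/-- **Type `II` with `ord Δ = 4` when `2` is a uniformiser: `2 ∣ a₁, a₄`, `a₃ ∈ 2R^×`,
`a₆ ∈ 2R^×`, and `8 ∣ b₈` or `b₈ ∈ 4R^×`.**  The Step-3 model (`kodairaSymbolOfMinimal_eq_II_imp`
with the Step-2 translation: `a₃, a₄, a₆ ∈ 2R`, `b₂ ∈ 2R` so `a₁ ∈ 2R`, `a₆ ∉ 4R`); `a₃/2` is a unit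
since otherwise `2⁶ ∣ Δ` (`two_pow_six_dvd_Δ_of_step3_of_four_dvd_a₃`); and
`b₈ = 4(α²a₆ + a₂a₆ - 2αγq + a₂γ² - q²) ∈ 4R`.  Silverman, *ATAEC* IV.9.4 Step 3 with `π = 2`
(Table 4.1: over `ℚ₂`, type `II` with `f = 4`). [cite: SilvermanATAEC1994, IV.9.4 Step 3] -/
theorem exists_smul_a_of_kodairaSymbolOfMinimal_eq_II_of_two_of_addVal_eq_four
    [PerfectField (ResidueField R)] (h2 : Irreducible (2 : R)) (V : WeierstrassCurve R)
    (hV : V.kodairaSymbolOfMinimal = .II) (hΔ : (addVal R V.Δ).toNat = 4) :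
    ∃ D : WeierstrassCurve.VariableChange R,
      2 ∣ (D • V).a₁ ∧ (∃ γ : R, IsUnit γ ∧ (D • V).a₃ = 2 * γ) ∧ 2 ∣ (D • V).a₄ ∧
      (∃ r : R, IsUnit r ∧ (D • V).a₆ = 2 * r) ∧
      ((2 : R) ^ 3 ∣ (D • V).b₈ ∨ ∃ w : R, IsUnit w ∧ (D • V).b₈ = 2 ^ 2 * w) ∧
      (addVal R (D • V).Δ).toNat = 4 := by
  obtain ⟨hΔm, hb₂, ha₆⟩ := kodairaSymbolOfMinimal_eq_II_imp V hV
  have hm : ∀ {x : R}, x ∈ maximalIdeal R ↔ (2 : R) ∣ x := fun {x} ↦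
    mem_maximalIdeal_iff_dvd_of_irreducible h2 x
  have hmn : ∀ {x : R} {n : ℕ}, x ∈ maximalIdeal R ^ n ↔ (2 : R) ^ n ∣ x := fun {x n} ↦
    mem_maximalIdeal_pow_iff_dvd_of_irreducible h2 x n
  -- the Step-2 translation
  have hex2 := exists_variableChange_step2_of_perfectField V hΔm
  have hN2 : normalizeStep2 V = hex2.choose • V := dif_pos hex2
  obtain ⟨hu, hA₃, hA₄, hA₆⟩ := hex2.choose_spec
  rw [hN2] at hb₂ ha₆
  set D := hex2.choose with hD
  set N := D • V with hN
  have ha₁ : (2 : R) ∣ N.a₁ := two_dvd_a₁_of_two_dvd_b₂ h2 N (hm.mp hb₂)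
  have ha₃ : (2 : R) ∣ N.a₃ := hm.mp hA₃
  have ha₄ : (2 : R) ∣ N.a₄ := hm.mp hA₄
  have ha₆2 : (2 : R) ∣ N.a₆ := hm.mp hA₆
  have ha₆4 : ¬ (2 : R) ^ 2 ∣ N.a₆ := fun h ↦ ha₆ (hmn.mpr h)
  -- `ord Δ(N) = ord Δ(V) = 4`
  have hΔN : (addVal R N.Δ).toNat = 4 := by
    rw [hN, Δ_smul_of_u_eq_one hu V, hΔ]
  -- `a₃ / 2` is a unit
  obtain ⟨γ, hγ⟩ := ha₃
  have hγu : IsUnit γ := by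
    rw [isUnit_iff_not_dvd h2]
    rintro ⟨γ₁, hγ₁⟩
    have h6 := two_pow_six_dvd_Δ_of_step3_of_four_dvd_a₃ N ha₁ ⟨γ₁, by rw [hγ, hγ₁]; ring⟩ ha₄ ha₆2
    have hN0 : N.Δ ≠ 0 := by
      intro h0
      rw [h0] at hΔN
      simp at hΔN
    have := le_addVal_toNat_of_pow_dvd h2 hN0 h6
    omega
  -- `a₆ / 2` is a unit
  obtain ⟨r, hr⟩ := ha₆2
  have hru : IsUnit r := by
    rw [isUnit_iff_not_dvd h2]
    rintro ⟨r₁, hr₁⟩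
    exact ha₆4 ⟨r₁, by rw [hr, hr₁]; ring⟩
  -- `b₈ ∈ 4R`, hence `8 ∣ b₈` or `b₈ = 4·unit`
  obtain ⟨α, hα⟩ := ha₁
  obtain ⟨q, hq⟩ := ha₄
  have hb₈ : N.b₈ = 2 ^ 2 * (α ^ 2 * N.a₆ + N.a₂ * N.a₆ - 2 * α * γ * q + N.a₂ * γ ^ 2 - q ^ 2) := by
    rw [WeierstrassCurve.b₈, hα, hγ, hq]; ring
  have hb₈' : (2 : R) ^ 3 ∣ N.b₈ ∨ ∃ w : R, IsUnit w ∧ N.b₈ = 2 ^ 2 * w := by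
    by_cases hw : IsUnit (α ^ 2 * N.a₆ + N.a₂ * N.a₆ - 2 * α * γ * q + N.a₂ * γ ^ 2 - q ^ 2)
    · exact Or.inr ⟨_, hw, hb₈⟩
    · obtain ⟨w₁, hw₁⟩ := (not_isUnit_iff_dvd h2 _).mp hw
      exact Or.inl ⟨w₁, by rw [hb₈, hw₁]; ring⟩
  exact ⟨D, ⟨α, hα⟩, ⟨γ, hγu, hγ⟩, ⟨q, hq⟩, ⟨r, hru, hr⟩, hb₈', hΔN⟩

end LocalIndex

end Literature.NumberTheory.EllipticCurves

end DVR

section Transfer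

open IsLocalRing
open IsDiscreteValuationRing hiding maximalIdeal

namespace WeierstrassCurve

open Literature.NumberTheory.EllipticCurves Literature.NumberTheory.DiophantineGeometry
  Literature.NumberTheory.DiophantineGeometry.TateAlgorithm Literature.NumberTheory.GaloisRepresentations
  IsDedekindDomain.HeightOneSpectrum

section Dedekind

variable {A : Type*} [CommRing A] [IsDedekindDomain A] {K' : Type*} [Field K'] [Algebra A K']
  [IsFractionRing A K'] (v : HeightOneSpectrum A) (X : WeierstrassCurve K')

/-- **From an `𝒪_v`-model with `2`-power shapes (including `b₈`) to a `K`-model** (`ord_v(2) = 1`).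
If an `𝒪_v`-change of variables `D` of the integral local minimal model `M` at `v` has
`2^{k₁} ∣ a₁`, `2^{k₂} ∣ a₂`, `a₃ = 2^{k₃}·unit`, `2^{k₄} ∣ a₄`, `a₆ = 2^{k₆}·unit`, `2^{k₈} ∣ b₈`
and `ord Δ = n`, then `ord_v(Δ_min) = n` and some change of variables **over `K`** gives a model
`C • X` with `ord_v(a₁) ≥ k₁`, `ord_v(a₂) ≥ k₂`, `ord_v(a₃) = k₃`, `ord_v(a₄) ≥ k₄`,
`ord_v(a₆) = k₆`, `ord_v(b₈) ≥ k₈`, `ord_v(Δ) = n`, and moreover `ord_v(b₈) = m` whenever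
`b₈(D • M) = 2^m·unit` (the coefficients and `b₈` are polynomial in `(u⁻¹, r, s, t)`, the conditions
are open, `K⁴` is dense in `K_v⁴`; the argument of `exists_variableChange_valuation_a_of_two`,
`OggFormulaTameTypesTwoProofs`).  Silverman, *AEC* VII.1 Remark 1.1; *ATAEC* IV.9.4.
[cite: SilvermanAEC2009, VII.1 Remark 1.1] [cite: SilvermanATAEC1994, IV.9.4] -/
theorem exists_variableChange_valuation_a_b₈_of_two [X.IsElliptic]
    (h2 : v.valuation K' (2 : K') = exp (-1 : ℤ)) {k₁ k₂ k₃ k₄ k₆ k₈ n : ℕ}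
    (D : VariableChange (v.adicCompletionIntegers K'))
    (ha₁ : (2 : v.adicCompletionIntegers K') ^ k₁ ∣ (D • X.localMinimalIntegralModel v).a₁)
    (ha₂ : (2 : v.adicCompletionIntegers K') ^ k₂ ∣ (D • X.localMinimalIntegralModel v).a₂)
    (ha₃' : ∃ γ : v.adicCompletionIntegers K', IsUnit γ ∧
      (D • X.localMinimalIntegralModel v).a₃ = 2 ^ k₃ * γ)
    (ha₄ : (2 : v.adicCompletionIntegers K') ^ k₄ ∣ (D • X.localMinimalIntegralModel v).a₄)
    (ha₆' : ∃ r : v.adicCompletionIntegers K', IsUnit r ∧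
      (D • X.localMinimalIntegralModel v).a₆ = 2 ^ k₆ * r)
    (hb₈ : (2 : v.adicCompletionIntegers K') ^ k₈ ∣ (D • X.localMinimalIntegralModel v).b₈)
    (hΔn : (addVal (v.adicCompletionIntegers K') (D • X.localMinimalIntegralModel v).Δ).toNat = n) :
    X.ordMinimalDiscriminant v = n ∧
    ∃ C : VariableChange K',
      v.valuation K' (C • X).a₁ ≤ exp (-(k₁ : ℤ)) ∧ v.valuation K' (C • X).a₂ ≤ exp (-(k₂ : ℤ)) ∧
      v.valuation K' (C • X).a₃ = exp (-(k₃ : ℤ)) ∧ v.valuation K' (C • X).a₄ ≤ exp (-(k₄ : ℤ)) ∧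
      v.valuation K' (C • X).a₆ = exp (-(k₆ : ℤ)) ∧ v.valuation K' (C • X).b₈ ≤ exp (-(k₈ : ℤ)) ∧
      (∀ {m : ℕ} {w : v.adicCompletionIntegers K'}, IsUnit w →
        (D • X.localMinimalIntegralModel v).b₈ = 2 ^ m * w → v.valuation K' (C • X).b₈ = exp (-(m : ℤ))) ∧
      v.valuation K' (C • X).Δ = exp (-(n : ℤ)) := by
  set φ := algebraMap K' (v.adicCompletion K') with hφ
  -- `2` is a uniformiser of `(v.adicCompletionIntegers K')`
  have h2v : Valued.v ((2 : (v.adicCompletionIntegers K')) : (v.adicCompletion K')) = exp (-1 : ℤ) := by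
    have : ((2 : (v.adicCompletionIntegers K')) : (v.adicCompletion K')) = φ 2 := by rw [hφ, map_ofNat]; rfl
    rw [this, hφ, valued_algebraMap_adicCompletion, h2]
  have h2irr : Irreducible (2 : (v.adicCompletionIntegers K')) := irreducible_adicCompletionIntegers_of_valued_eq v 2 h2v
  set M := X.localMinimalIntegralModel v with hM
  obtain ⟨γ, hγ, ha₃⟩ := ha₃'
  obtain ⟨r, hr, ha₆⟩ := ha₆'
  set N := D • M with hN
  -- `ord_v(Δ_min) = n`
  have hΔM0 : M.Δ ≠ 0 := localMinimalIntegralModel_Δ_ne_zero v X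
  have hΔN : N.Δ = ↑D.u⁻¹ ^ 12 * M.Δ := by rw [hN, variableChange_Δ]
  have hordN : addVal (v.adicCompletionIntegers K') N.Δ = addVal (v.adicCompletionIntegers K') M.Δ := by
    rw [hΔN, addVal_mul, addVal_pow, addVal_eq_zero_of_unit, nsmul_zero, zero_add]
  have hord : X.ordMinimalDiscriminant v = n := by
    rw [ordMinimalDiscriminant, ← hM, ← hordN, hΔn]
  refine ⟨hord, ?_⟩
  -- valuations of the coefficients of `N` in `K_v`
  have hle : ∀ {x : (v.adicCompletionIntegers K')} {k : ℕ}, (2 : (v.adicCompletionIntegers K')) ^ k ∣ x → Valued.v (x : (v.adicCompletion K')) ≤ exp (-(k : ℤ)) := by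
    rintro x k ⟨y, rfl⟩
    push_cast
    rw [Valuation.map_mul, Valuation.map_pow, h2v, ← exp_nsmul, nsmul_eq_mul, mul_neg, mul_one]
    exact mul_le_of_le_one_right' ((mem_adicCompletionIntegers _ _ _).mp y.2)
  have heq : ∀ {x : (v.adicCompletionIntegers K')} {k : ℕ} {w : (v.adicCompletionIntegers K')}, IsUnit w → x = 2 ^ k * w →
      Valued.v (x : (v.adicCompletion K')) = exp (-(k : ℤ)) := by
    rintro x k w hw rfl
    push_cast
    rw [Valuation.map_mul, Valuation.map_pow, h2v, ← exp_nsmul, nsmul_eq_mul, mul_neg, mul_one,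
      adicCompletionIntegers.isUnit_iff_valued_eq_one.mp hw, mul_one]
  have hN₁ : Valued.v (N.a₁ : (v.adicCompletion K')) ≤ exp (-(k₁ : ℤ)) := hle ha₁
  have hN₂ : Valued.v (N.a₂ : (v.adicCompletion K')) ≤ exp (-(k₂ : ℤ)) := hle ha₂
  have hN₄ : Valued.v (N.a₄ : (v.adicCompletion K')) ≤ exp (-(k₄ : ℤ)) := hle ha₄
  have hN₈ : Valued.v (N.b₈ : (v.adicCompletion K')) ≤ exp (-(k₈ : ℤ)) := hle hb₈
  have hN₃ : Valued.v (N.a₃ : (v.adicCompletion K')) = exp (-(k₃ : ℤ)) := heq hγ ha₃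
  have hN₆ : Valued.v (N.a₆ : (v.adicCompletion K')) = exp (-(k₆ : ℤ)) := heq hr ha₆
  have hNΔ0 : N.Δ ≠ 0 := by
    rw [hΔN]; exact mul_ne_zero (pow_ne_zero _ (Units.ne_zero _)) hΔM0
  have hNΔ : Valued.v (N.Δ : (v.adicCompletion K')) = exp (-(n : ℤ)) := by
    obtain ⟨m, u₀, hmu⟩ := eq_unit_mul_pow_irreducible hNΔ0 h2irr
    have hm : m = n := by
      have h := addVal_def N.Δ u₀ h2irr m hmu
      rw [← hΔn, h]; simp
    rw [hmu]
    push_cast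
    rw [Valuation.map_mul, Valuation.map_pow, h2v, ← exp_nsmul, nsmul_eq_mul, mul_neg, mul_one,
      adicCompletionIntegers.isUnit_iff_valued_eq_one.mp (Units.isUnit u₀), one_mul, hm]
  -- the `K_v`-model `C • X_v = N`
  obtain ⟨C₀, hC₀⟩ : ∃ C₀ : VariableChange (v.adicCompletion K'), C₀ • X.baseChange (v.adicCompletion K') = X.localMinimalModel v :=
    ⟨_, rfl⟩
  have hMK : M.map (algebraMap (v.adicCompletionIntegers K') (v.adicCompletion K')) = X.localMinimalModel v := by
    rw [hM, localMinimalIntegralModel]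
    exact baseChange_integralModel_eq (v.adicCompletionIntegers K') (X.localMinimalModel v)
  set C : VariableChange (v.adicCompletion K') := D.map (algebraMap (v.adicCompletionIntegers K') (v.adicCompletion K')) * C₀ with hC
  set Xv := X.baseChange (v.adicCompletion K') with hXv
  have hNK : N.map (algebraMap (v.adicCompletionIntegers K') (v.adicCompletion K')) = C • Xv := by
    rw [hC, mul_smul, hXv, hC₀, ← hMK, hN, map_variableChange]
  have hC₁ : Valued.v (C • Xv).a₁ ≤ exp (-(k₁ : ℤ)) := by rw [← hNK, map_a₁]; exact hN₁
  have hC₂ : Valued.v (C • Xv).a₂ ≤ exp (-(k₂ : ℤ)) := by rw [← hNK, map_a₂]; exact hN₂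
  have hC₃ : Valued.v (C • Xv).a₃ = exp (-(k₃ : ℤ)) := by rw [← hNK, map_a₃]; exact hN₃
  have hC₄ : Valued.v (C • Xv).a₄ ≤ exp (-(k₄ : ℤ)) := by rw [← hNK, map_a₄]; exact hN₄
  have hC₆ : Valued.v (C • Xv).a₆ = exp (-(k₆ : ℤ)) := by rw [← hNK, map_a₆]; exact hN₆
  have hC₈ : Valued.v (C • Xv).b₈ ≤ exp (-(k₈ : ℤ)) := by rw [← hNK, map_b₈]; exact hN₈
  have hCΔ : Valued.v (C • Xv).Δ = exp (-(n : ℤ)) := by rw [← hNK, map_Δ]; exact hNΔ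
  -- continuity of `b₈` in the parameters
  have hb₈c : Continuous fun p ↦ (Xv.polyVariableChange p).b₈ := by
    have h1 := Xv.continuous_polyVariableChange_a₁
    have h2 := Xv.continuous_polyVariableChange_a₂
    have h3 := Xv.continuous_polyVariableChange_a₃
    have h4 := Xv.continuous_polyVariableChange_a₄
    have h6 := Xv.continuous_polyVariableChange_a₆
    simp only [WeierstrassCurve.b₈]
    exact ((((h1.pow 2).mul h6).add ((continuous_const.mul h2).mul h6)).sub
      ((h1.mul h3).mul h4)).add (h2.mul (h3.pow 2)) |>.sub (h4.pow 2)
  -- approximation of `(u⁻¹, r, s, t)` by elements of `K`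
  have hu0 : Valued.v (↑C.u⁻¹ : (v.adicCompletion K')) ≠ 0 := by simp
  set p₀ : (v.adicCompletion K') × (v.adicCompletion K') × (v.adicCompletion K') × (v.adicCompletion K') := ((↑C.u⁻¹ : (v.adicCompletion K')), C.r, C.s, C.t) with hp₀_def
  set S : Set ((v.adicCompletion K') × (v.adicCompletion K') × (v.adicCompletion K') × (v.adicCompletion K')) :=
    {p | Valued.v p.1 = Valued.v (↑C.u⁻¹ : (v.adicCompletion K'))} ∩
      ({p | Valued.v (Xv.polyVariableChange p).a₁ ≤ exp (-(k₁ : ℤ))} ∩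
      {p | Valued.v (Xv.polyVariableChange p).a₂ ≤ exp (-(k₂ : ℤ))} ∩
      {p | Valued.v (Xv.polyVariableChange p).a₃ = exp (-(k₃ : ℤ))} ∩
      {p | Valued.v (Xv.polyVariableChange p).a₄ ≤ exp (-(k₄ : ℤ))} ∩
      {p | Valued.v (Xv.polyVariableChange p).a₆ = exp (-(k₆ : ℤ))} ∩
      {p | Valued.v (Xv.polyVariableChange p).b₈ ≤ exp (-(k₈ : ℤ))} ∩
      {p | N.b₈ = 0 ∨ Valued.v (Xv.polyVariableChange p).b₈ = Valued.v (N.b₈ : (v.adicCompletion K'))}) with hS_def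
  have hp₀ : C • Xv = Xv.polyVariableChange p₀ := variableChange_eq_polyVariableChange Xv C
  have hexact : ∀ {f : (v.adicCompletion K') × (v.adicCompletion K') × (v.adicCompletion K') × (v.adicCompletion K') → (v.adicCompletion K')} (_ : Continuous f) {k : ℕ}
      (_ : Valued.v (f p₀) = exp (-(k : ℤ))), {p | Valued.v (f p) = exp (-(k : ℤ))} ∈ nhds p₀ := by
    intro f hf k hfk
    have hT := Valued.locally_const (x := f p₀) (by rw [hfk]; exact exp_ne_zero)
    have h := hf.continuousAt.preimage_mem_nhds hT
    simpa only [Set.preimage_setOf_eq, hfk] using h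
  have hS : S ∈ nhds p₀ := by
    refine Filter.inter_mem ?_ (Filter.inter_mem (Filter.inter_mem (Filter.inter_mem (Filter.inter_mem
      (Filter.inter_mem (Filter.inter_mem ?_ ?_) ?_) ?_) ?_) ?_) ?_)
    · exact continuous_fst.continuousAt.preimage_mem_nhds (Valued.locally_const hu0)
    · refine (Xv.continuous_polyVariableChange_a₁).continuousAt.preimage_mem_nhds
        (setOf_valued_le_exp_mem_nhds v _ ?_)
      rw [← hp₀]; exact hC₁
    · refine (Xv.continuous_polyVariableChange_a₂).continuousAt.preimage_mem_nhds
        (setOf_valued_le_exp_mem_nhds v _ ?_)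
      rw [← hp₀]; exact hC₂
    · exact hexact (Xv.continuous_polyVariableChange_a₃) (by rw [← hp₀]; exact hC₃)
    · refine (Xv.continuous_polyVariableChange_a₄).continuousAt.preimage_mem_nhds
        (setOf_valued_le_exp_mem_nhds v _ ?_)
      rw [← hp₀]; exact hC₄
    · exact hexact (Xv.continuous_polyVariableChange_a₆) (by rw [← hp₀]; exact hC₆)
    · refine hb₈c.continuousAt.preimage_mem_nhds (setOf_valued_le_exp_mem_nhds v _ ?_)
      rw [← hp₀]; exact hC₈
    · by_cases hN0 : N.b₈ = 0
      · exact Filter.univ_mem' fun p ↦ Or.inl hN0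
      · have hb₈0 : Valued.v (Xv.polyVariableChange p₀).b₈ = Valued.v (N.b₈ : (v.adicCompletion K')) := by
          rw [← hp₀, ← hNK, map_b₈]; rfl
        have hne : Valued.v (Xv.polyVariableChange p₀).b₈ ≠ 0 := by
          rw [hb₈0, Valuation.ne_zero_iff]
          exact_mod_cast hN0
        have hT := Valued.locally_const (x := (Xv.polyVariableChange p₀).b₈) hne
        have h := hb₈c.continuousAt.preimage_mem_nhds hT
        refine Filter.mem_of_superset h fun p hp ↦ Or.inr ?_
        simp only [Set.mem_preimage, Set.mem_setOf_eq] at hp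
        rw [hp, hb₈0]
  have hd : DenseRange φ := HeightOneSpectrum.denseRange_algebraMap K' v
  obtain ⟨⟨w', r', s', t'⟩, hwv, ⟨⟨⟨⟨⟨⟨h₁, h₂'⟩, h₃⟩, h₄⟩, h₆⟩, h₈⟩, h₈'⟩⟩ :=
    (hd.prodMap (hd.prodMap (hd.prodMap hd))).mem_nhds hS
  simp only [Prod.map_apply, Set.mem_setOf_eq] at hwv h₁ h₂' h₃ h₄ h₆ h₈ h₈'
  have hw' : w' ≠ 0 := by
    rintro rfl
    rw [map_zero, Valuation.map_zero] at hwv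
    exact hu0 hwv.symm
  set C' : VariableChange K' := ⟨(Units.mk0 w' hw')⁻¹, r', s', t'⟩ with hC'_def
  have hC'W : (C' • X).baseChange (v.adicCompletion K') = Xv.polyVariableChange (φ w', φ r', φ s', φ t') := by
    rw [variableChange_eq_polyVariableChange, baseChange, map_polyVariableChange]
    simp [C', hXv, hφ, baseChange]
  have hval : ∀ x : K', v.valuation K' x = Valued.v (φ x) := fun x ↦ by
    rw [hφ, valued_algebraMap_adicCompletion]
  have hb₈K : φ (C' • X).b₈ = ((C' • X).baseChange (v.adicCompletion K')).b₈ := by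
    simp only [baseChange, map_b₈]; rfl
  refine ⟨C', ?_, ?_, ?_, ?_, ?_, ?_, ?_, ?_⟩
  · rw [hval, show φ (C' • X).a₁ = ((C' • X).baseChange (v.adicCompletion K')).a₁ from rfl, hC'W]; exact h₁
  · rw [hval, show φ (C' • X).a₂ = ((C' • X).baseChange (v.adicCompletion K')).a₂ from rfl, hC'W]; exact h₂'
  · rw [hval, show φ (C' • X).a₃ = ((C' • X).baseChange (v.adicCompletion K')).a₃ from rfl, hC'W]; exact h₃
  · rw [hval, show φ (C' • X).a₄ = ((C' • X).baseChange (v.adicCompletion K')).a₄ from rfl, hC'W]; exact h₄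
  · rw [hval, show φ (C' • X).a₆ = ((C' • X).baseChange (v.adicCompletion K')).a₆ from rfl, hC'W]; exact h₆
  · rw [hval, hb₈K, hC'W]; exact h₈
  · intro m w hw hmw
    have hN0 : N.b₈ ≠ 0 := by
      rw [hmw]
      exact mul_ne_zero (pow_ne_zero _ h2irr.ne_zero) hw.ne_zero
    rw [hval, hb₈K, hC'W, h₈'.resolve_left hN0]
    exact heq hw hmw
  · rw [hval, variableChange_Δ, inv_inv, Units.val_mk0, map_mul, map_pow, Valuation.map_mul,
      Valuation.map_pow, hwv, ← hCΔ, variableChange_Δ, Valuation.map_mul, Valuation.map_pow]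
    simp only [hXv, baseChange, map_Δ]
    rfl

end Dedekind

end WeierstrassCurve

end Transfer

/-! ## §3. Type `II`, `ord₂ Δ_min = 4`, `8 ∣ b₈`: the twist by `-1` is potentially good over `ℚ(∛2)` -/

namespace WeierstrassCurve

open Literature.NumberTheory.EllipticCurves Literature.NumberTheory.GaloisRepresentations
  IsDedekindDomain.HeightOneSpectrum Rat.HeightOneSpectrum

variable (X : WeierstrassCurve ℚ)

/-- **The twist by `-1` of a `C₆`-curve of type `II`, `ord₂ Δ = 4`, has the shape of type `IV`.**
Let `X/ℚ` have `ord₂(a₁) ≥ 1`, `ord₂(a₂) ≥ 0`, `ord₂(a₃) = 1`, `ord₂(a₄) ≥ 1`, `ord₂(a₆) = 1`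
(the normal form of type `II` with `ord₂ Δ = 4`), `ord₂(Δ) = 4`, and `ord₂(b₈) ≥ 3`.  Write
`a₁ = 2α`, `a₃ = 2γ`, `a₄ = 2q`, `a₆ = 2r` (`γ, r` units); `b₈ = 4(2α²r + 2a₂r - 2αγq + a₂γ² - q²)`,
so `8 ∣ b₈` gives `a₂ ≡ q (mod 2)` (`γ² ≡ 1 (mod 8)`, `q² ≡ q (mod 2)`).  The twist
`X^{(-1)} : y² = x³ - (α² + a₂)x² + 2(q + αγ)x - (γ² + 2r)` under `y ↦ y + sx + 1`, with `s = 0`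
if `α² + a₂` is even and `s = 1` if it is a unit, becomes `a₁' = 2s`, `a₂' = -(α² + a₂) - s²`
(even), `a₃' = 2`, `a₄' = 2(q + αγ - s)` with `q + αγ - s = (q - a₂) + (a₂ + α² - s) + α(γ - 1) -
α(α - 1) ≡ 0 (mod 2)`, `a₆' = -(γ² - 1) - 2(r + 1) ∈ 4ℤ₂`, `Δ' = Δ`: the shape
`(ord aᵢ) ≥ (1, 1, 1, 2, 2)`, `ord Δ = 4` of Kodaira type `IV` (*ATAEC* IV.9.4 Step 5), which by
`hasGoodReductionAt_baseChange_of_pow_three_eq` means potential good reduction over `ℚ(∛2)`.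
[cite: SilvermanATAEC1994, IV.9.4 Steps 3–5 and Table 4.1] [cite: SilvermanAEC2009, X.5 Cor. 5.4] -/
theorem exists_variableChange_quadraticTwist_neg_one_of_II_four_of_valuation_b₈_le
    {v : HeightOneSpectrum (𝓞 ℚ)} (hv : (2 : 𝓞 ℚ) ∈ v.asIdeal)
    (h₁ : v.valuation ℚ X.a₁ ≤ exp (-1 : ℤ)) (h₂ : v.valuation ℚ X.a₂ ≤ 1)
    (h₃ : v.valuation ℚ X.a₃ = exp (-1 : ℤ)) (h₄ : v.valuation ℚ X.a₄ ≤ exp (-1 : ℤ))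
    (h₆ : v.valuation ℚ X.a₆ = exp (-1 : ℤ)) (h₈ : v.valuation ℚ X.b₈ ≤ exp (-3 : ℤ))
    (hΔ : v.valuation ℚ X.Δ = exp (-4 : ℤ)) :
    ∃ C : VariableChange ℚ,
      v.valuation ℚ (C • X.quadraticTwist (-1)).a₁ ≤ exp (-(1 : ℕ) : ℤ) ∧
      v.valuation ℚ (C • X.quadraticTwist (-1)).a₂ ≤ exp (-(1 : ℕ) : ℤ) ∧
      v.valuation ℚ (C • X.quadraticTwist (-1)).a₃ ≤ exp (-(1 : ℕ) : ℤ) ∧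
      v.valuation ℚ (C • X.quadraticTwist (-1)).a₄ ≤ exp (-(2 : ℕ) : ℤ) ∧
      v.valuation ℚ (C • X.quadraticTwist (-1)).a₆ ≤ exp (-(2 : ℕ) : ℤ) ∧
      v.valuation ℚ (C • X.quadraticTwist (-1)).Δ = exp (-(4 : ℕ) : ℤ) := by
  have hv2 : natGenerator v = 2 := Rat.natGenerator_eq_two hv
  set Kv := v.adicCompletion ℚ with hKv
  set φ := algebraMap ℚ Kv with hφ
  have hval : ∀ x : ℚ, v.valuation ℚ x = Valued.v (φ x) := fun x ↦ by
    rw [hφ, valued_algebraMap_adicCompletion]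
  have V2 : Valued.v (2 : Kv) = exp (-1 : ℤ) := valued_two v hv2
  have h20 : (2 : Kv) ≠ 0 := by
    intro h; rw [h, Valuation.map_zero] at V2; exact exp_ne_zero V2.symm
  have h40 : (4 : Kv) ≠ 0 := by
    rw [show (4 : Kv) = 2 * 2 by norm_num]; exact mul_ne_zero h20 h20
  -- the halves `α, γ, q, r` of `a₁, a₃, a₄, a₆` in `K_v`
  set α : Kv := φ X.a₁ / 2 with hα
  set γ : Kv := φ X.a₃ / 2 with hγ
  set q : Kv := φ X.a₄ / 2 with hq
  set r : Kv := φ X.a₆ / 2 with hr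
  set A : Kv := φ X.a₂ with hA
  have hdiv : ∀ {x : ℚ} {g : WithZero (Multiplicative ℤ)}, v.valuation ℚ x ≤ g * exp (-1 : ℤ) →
      Valued.v (φ x / 2) ≤ g := by
    intro x g hx
    rw [map_div₀, V2, div_le_iff₀ (by exact zero_lt_iff.mpr exp_ne_zero), ← hval]; exact hx
  have hdiv' : ∀ {x : ℚ} {g : WithZero (Multiplicative ℤ)}, v.valuation ℚ x = g * exp (-1 : ℤ) →
      Valued.v (φ x / 2) = g := by
    intro x g hx
    rw [map_div₀, V2, div_eq_iff exp_ne_zero, ← hval]; exact hx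
  have hαv : Valued.v α ≤ 1 := hdiv (by rw [one_mul]; exact h₁)
  have hγv : Valued.v γ = 1 := hdiv' (by rw [one_mul]; exact h₃)
  have hqv : Valued.v q ≤ 1 := hdiv (by rw [one_mul]; exact h₄)
  have hrv : Valued.v r = 1 := hdiv' (by rw [one_mul]; exact h₆)
  have hAv : Valued.v A ≤ 1 := by rw [hA, ← hval]; exact h₂
  have ha₁ : φ X.a₁ = 2 * α := by rw [hα, mul_div_cancel₀ _ h20]
  have ha₃ : φ X.a₃ = 2 * γ := by rw [hγ, mul_div_cancel₀ _ h20]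
  have ha₄ : φ X.a₄ = 2 * q := by rw [hq, mul_div_cancel₀ _ h20]
  have ha₆ : φ X.a₆ = 2 * r := by rw [hr, mul_div_cancel₀ _ h20]
  -- `2`-adic congruences: units are `≡ 1 (mod 2)`, `x(x - 1) ∈ 2𝓞`, `γ² ≡ 1 (mod 8)`
  have hunit : ∀ {x : Kv}, Valued.v x = 1 → Valued.v (x - 1) ≤ exp (-1 : ℤ) := fun {x} hx ↦
    valued_le_exp_neg_one_of_lt_one v
      ((valued_lt_one_or_valued_sub_one_lt_one v hv2 hx.le).resolve_left (by rw [hx]; exact lt_irrefl 1))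
  have hprod : ∀ {x : Kv}, Valued.v x ≤ 1 → Valued.v (x * (x - 1)) ≤ exp (-1 : ℤ) := by
    intro x hx
    rw [Valuation.map_mul]
    rcases valued_lt_one_or_valued_sub_one_lt_one v hv2 hx with h | h
    · exact (mul_le_mul' (valued_le_exp_neg_one_of_lt_one v h)
        (Valuation.map_sub_le _ hx (by rw [Valuation.map_one]))).trans (by rw [mul_one])
    · exact (mul_le_mul' hx (valued_le_exp_neg_one_of_lt_one v h)).trans (by rw [one_mul])
  have hγ1 : Valued.v (γ - 1) ≤ exp (-1 : ℤ) := hunit hγv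
  have hγsq : Valued.v (γ ^ 2 - 1) ≤ exp (-3 : ℤ) := valued_sq_sub_one_le_of_valued_eq_one v hv2 hγv
  have hr1 : Valued.v (r + 1) ≤ exp (-1 : ℤ) := by
    have := hunit hrv
    have e : r + 1 = (r - 1) + 2 := by ring
    rw [e]; exact Valuation.map_add_le _ this V2.le
  -- `a₂ ≡ q (mod 2)` from `8 ∣ b₈ = 4(2α²r + 2Ar - 2αγq + Aγ² - q²)`
  have hb₈ : φ X.b₈ = 2 ^ 2 * (2 * α ^ 2 * r + 2 * A * r - 2 * α * γ * q + A * γ ^ 2 - q ^ 2) := by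
    have : φ X.b₈ = (φ X.a₁) ^ 2 * φ X.a₆ + 4 * φ X.a₂ * φ X.a₆ - φ X.a₁ * φ X.a₃ * φ X.a₄ +
        φ X.a₂ * (φ X.a₃) ^ 2 - (φ X.a₄) ^ 2 := by
      simp only [WeierstrassCurve.b₈, map_add, map_sub, map_mul, map_pow, map_ofNat]
    rw [this, ha₁, ha₃, ha₄, ha₆, hA]; ring
  have hAq : Valued.v (A - q) ≤ exp (-1 : ℤ) := by
    have hin : Valued.v (2 * α ^ 2 * r + 2 * A * r - 2 * α * γ * q + A * γ ^ 2 - q ^ 2) ≤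
        exp (-1 : ℤ) := by
      have h := h₈
      rw [hval] at h
      have e : 2 * α ^ 2 * r + 2 * A * r - 2 * α * γ * q + A * γ ^ 2 - q ^ 2 = φ X.b₈ / 2 ^ 2 := by
        rw [hb₈, mul_div_cancel_left₀ _ (pow_ne_zero 2 h20)]
      rw [e, map_div₀, Valuation.map_pow, V2, div_le_iff₀ (pow_pos (zero_lt_iff.mpr exp_ne_zero) 2),
        ← exp_nsmul, ← exp_add]
      exact h.trans (by norm_num)
    have e : A - q = (2 * α ^ 2 * r + 2 * A * r - 2 * α * γ * q + A * γ ^ 2 - q ^ 2) -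
        2 * (α ^ 2 * r + A * r - α * γ * q) - A * (γ ^ 2 - 1) + q * (q - 1) := by ring
    rw [e]
    refine Valuation.map_add_le _ (Valuation.map_sub_le _ (Valuation.map_sub_le _ hin ?_) ?_) (hprod hqv)
    · rw [Valuation.map_mul, V2]
      refine (mul_le_mul' le_rfl ?_).trans (by rw [mul_one])
      refine Valuation.map_sub_le _ (Valuation.map_add_le _ ?_ ?_) ?_
      · rw [Valuation.map_mul, Valuation.map_pow, hrv, mul_one]
        exact pow_le_one' hαv 2
      · rw [Valuation.map_mul, hrv, mul_one]; exact hAv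
      · rw [Valuation.map_mul, Valuation.map_mul, hγv, mul_one]; exact mul_le_one' hαv hqv
    · rw [Valuation.map_mul]
      exact (mul_le_mul' hAv hγsq).trans (by rw [one_mul, exp_le_exp]; norm_num)
  -- the coefficients of `X⁻ = X.quadraticTwist (-1)`: `A₂ = -(α² + A)`, `A₄ = 2(q + αγ)`,
  -- `A₆ = -(γ² + 2r)`
  set Xm := X.quadraticTwist (-1) with hXm
  have hA₁ : Xm.a₁ = 0 := rfl
  have hA₃ : Xm.a₃ = 0 := rfl
  have hA₂ : φ Xm.a₂ = -(α ^ 2 + A) := by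
    rw [hXm, quadraticTwist_a₂, WeierstrassCurve.b₂]
    simp only [map_div₀, map_mul, map_add, map_pow, map_neg, map_one, map_ofNat]
    rw [ha₁, hA, div_eq_iff h40]
    ring
  have hA₄ : φ Xm.a₄ = 2 * (q + α * γ) := by
    rw [hXm, quadraticTwist_a₄, WeierstrassCurve.b₄]
    simp only [map_div₀, map_mul, map_add, map_pow, map_neg, map_one, map_ofNat]
    rw [ha₁, ha₃, ha₄, div_eq_iff h20]
    ring
  have hA₆ : φ Xm.a₆ = -(γ ^ 2 + 2 * r) := by
    rw [hXm, quadraticTwist_a₆, WeierstrassCurve.b₆]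
    simp only [map_div₀, map_mul, map_add, map_pow, map_neg, map_one, map_ofNat]
    rw [ha₃, ha₆, div_eq_iff h40]
    ring
  have hΔm : Xm.Δ = X.Δ := by rw [hXm, quadraticTwist_Δ]; norm_num
  -- `A₆ - 1 ∈ 4𝓞`
  have hY₆ : Valued.v (φ Xm.a₆ - 1) ≤ exp (-2 : ℤ) := by
    rw [hA₆]
    have e : -(γ ^ 2 + 2 * r) - 1 = -(γ ^ 2 - 1) - 2 * (r + 1) := by ring
    rw [e]
    refine Valuation.map_sub_le _ ?_ ?_
    · rw [Valuation.map_neg]; exact hγsq.trans (by rw [exp_le_exp]; norm_num)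
    · rw [Valuation.map_mul, V2]
      exact (mul_le_mul' le_rfl hr1).trans (by rw [← exp_add]; norm_num)
  -- the coefficients of `⟨1, 0, s, 1⟩ • X⁻` for `s = 0, 1`
  have e0₁ : ((⟨1, 0, 0, 1⟩ : VariableChange ℚ) • Xm).a₁ = 0 := by
    rw [variableChange_a₁, hA₁]; simp
  have e0₂ : ((⟨1, 0, 0, 1⟩ : VariableChange ℚ) • Xm).a₂ = Xm.a₂ := by
    rw [variableChange_a₂, hA₁]; simp
  have e0₃ : ((⟨1, 0, 0, 1⟩ : VariableChange ℚ) • Xm).a₃ = 2 := by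
    rw [variableChange_a₃, hA₁, hA₃]; simp
  have e0₄ : ((⟨1, 0, 0, 1⟩ : VariableChange ℚ) • Xm).a₄ = Xm.a₄ := by
    rw [variableChange_a₄, hA₁, hA₃]; simp
  have e0₆ : ((⟨1, 0, 0, 1⟩ : VariableChange ℚ) • Xm).a₆ = Xm.a₆ - 1 := by
    rw [variableChange_a₆, hA₁, hA₃]; simp
  have e0Δ : ((⟨1, 0, 0, 1⟩ : VariableChange ℚ) • Xm).Δ = X.Δ := by
    rw [variableChange_Δ, hΔm]; simp
  have e1₁ : ((⟨1, 0, 1, 1⟩ : VariableChange ℚ) • Xm).a₁ = 2 := by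
    rw [variableChange_a₁, hA₁]; simp
  have e1₂ : ((⟨1, 0, 1, 1⟩ : VariableChange ℚ) • Xm).a₂ = Xm.a₂ - 1 := by
    rw [variableChange_a₂, hA₁]; simp
  have e1₃ : ((⟨1, 0, 1, 1⟩ : VariableChange ℚ) • Xm).a₃ = 2 := by
    rw [variableChange_a₃, hA₁, hA₃]; simp
  have e1₄ : ((⟨1, 0, 1, 1⟩ : VariableChange ℚ) • Xm).a₄ = Xm.a₄ - 2 := by
    rw [variableChange_a₄, hA₁, hA₃]; simp
  have e1₆ : ((⟨1, 0, 1, 1⟩ : VariableChange ℚ) • Xm).a₆ = Xm.a₆ - 1 := by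
    rw [variableChange_a₆, hA₁, hA₃]; simp
  have e1Δ : ((⟨1, 0, 1, 1⟩ : VariableChange ℚ) • Xm).Δ = X.Δ := by
    rw [variableChange_Δ, hΔm]; simp
  have hφ2 : Valued.v (φ 2) = exp (-1 : ℤ) := by rw [map_ofNat, V2]
  have htwo : exp (-2 : ℤ) = exp (-1 : ℤ) * exp (-1 : ℤ) := by rw [← exp_add]; norm_num
  -- case split on the parity of `α² + A`
  have hsum : Valued.v (α ^ 2 + A) ≤ 1 :=
    Valuation.map_add_le _ (by rw [Valuation.map_pow]; exact pow_le_one' hαv 2) hAv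
  by_cases hpar : Valued.v (α ^ 2 + A) < 1
  · -- `s = 0`
    have hpar' : Valued.v (α ^ 2 + A) ≤ exp (-1 : ℤ) := valued_le_exp_neg_one_of_lt_one v hpar
    refine ⟨⟨1, 0, 0, 1⟩, ?_, ?_, ?_, ?_, ?_, ?_⟩
    · rw [e0₁, Valuation.map_zero]; exact zero_le
    · rw [e0₂, hval, hA₂, Valuation.map_neg]; simpa using hpar'
    · rw [e0₃, hval, hφ2]; simp
    · rw [e0₄, hval, hA₄]
      have e : q + α * γ = (q - A) + (α ^ 2 + A) + α * (γ - 1) - α * (α - 1) := by ring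
      rw [Valuation.map_mul, V2, e, Nat.cast_ofNat, htwo]
      refine mul_le_mul' le_rfl (Valuation.map_sub_le _ (Valuation.map_add_le _
        (Valuation.map_add_le _ ?_ hpar') ?_) (hprod hαv))
      · rw [← Valuation.map_neg, neg_sub]; exact hAq
      · rw [Valuation.map_mul]; exact (mul_le_mul' hαv hγ1).trans (by rw [one_mul])
    · rw [e0₆, hval, map_sub, map_one]; exact hY₆
    · rw [e0Δ]; simpa using hΔ
  · -- `s = 1`: `α² + A` is a unit
    have hpar' : Valued.v (α ^ 2 + A) = 1 := le_antisymm hsum (not_lt.mp hpar)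
    have hparm : Valued.v (α ^ 2 + A - 1) ≤ exp (-1 : ℤ) := hunit hpar'
    refine ⟨⟨1, 0, 1, 1⟩, ?_, ?_, ?_, ?_, ?_, ?_⟩
    · rw [e1₁, hval, hφ2]; simp
    · rw [e1₂, hval, map_sub, map_one, hA₂]
      have e : -(α ^ 2 + A) - 1 = -(α ^ 2 + A - 1) - 2 := by ring
      rw [e]
      have hn : Valued.v (-(α ^ 2 + A - 1)) ≤ exp (-1 : ℤ) := by rw [Valuation.map_neg]; exact hparm
      simpa using Valuation.map_sub_le _ hn V2.le
    · rw [e1₃, hval, hφ2]; simp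
    · rw [e1₄, hval, map_sub, map_ofNat, hA₄]
      have e : 2 * (q + α * γ) - 2 = 2 * ((q - A) + (α ^ 2 + A - 1) + α * (γ - 1) - α * (α - 1)) := by
        ring
      rw [e, Valuation.map_mul, V2, Nat.cast_ofNat, htwo]
      refine mul_le_mul' le_rfl (Valuation.map_sub_le _ (Valuation.map_add_le _
        (Valuation.map_add_le _ ?_ hparm) ?_) (hprod hαv))
      · rw [← Valuation.map_neg, neg_sub]; exact hAq
      · rw [Valuation.map_mul]; exact (mul_le_mul' hαv hγ1).trans (by rw [one_mul])
    · rw [e1₆, hval, map_sub, map_one]; exact hY₆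
    · rw [e1Δ]; simpa using hΔ

end WeierstrassCurve

/-! ## §4. Over `ℚ`: the `C₆`-branch of type `II`, `ord₂ Δ_min = 4` -/

namespace WeierstrassCurve

open Literature.NumberTheory.EllipticCurves Literature.NumberTheory.GaloisRepresentations
  Literature.NumberTheory.DiophantineGeometry Literature.NumberTheory.DiophantineGeometry.TateAlgorithm
  IsDedekindDomain.HeightOneSpectrum

variable (W : WeierstrassCurve ℚ)

/-- **Type `II` with `ord₂ Δ_min = 4` over `ℚ`: a `ℚ`-model `y² + a₁xy + a₃y = x³ + a₂x² + a₄x + a₆`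
with `ord₂(a₁) ≥ 1`, `ord₂(a₂) ≥ 0`, `ord₂(a₃) = 1`, `ord₂(a₄) ≥ 1`, `ord₂(a₆) = 1`, `ord₂(Δ) = 4`,
and the dichotomy `ord₂(b₈) ≥ 3` (`Φ = C₆`) or `ord₂(b₈) = 2`** (*ATAEC* IV.9.4 Step 3 with
`π = 2`, `exists_smul_a_of_kodairaSymbolOfMinimal_eq_II_of_two_of_addVal_eq_four`, made `ℚ`-rational
by `exists_variableChange_valuation_a_b₈_of_two`). [cite: SilvermanATAEC1994, IV.9.4 Step 3 and Table 4.1] -/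
theorem exists_variableChange_of_kodairaSymbolAt_II_of_ordMinimalDiscriminant_eq_four [W.IsElliptic]
    {v : HeightOneSpectrum (𝓞 ℚ)} (hv : (2 : 𝓞 ℚ) ∈ v.asIdeal) (hT : W.kodairaSymbolAt v = .II)
    (hord : W.ordMinimalDiscriminant v = 4) :
    ∃ C : VariableChange ℚ,
      v.valuation ℚ (C • W).a₁ ≤ exp (-1 : ℤ) ∧ v.valuation ℚ (C • W).a₂ ≤ 1 ∧
      v.valuation ℚ (C • W).a₃ = exp (-1 : ℤ) ∧ v.valuation ℚ (C • W).a₄ ≤ exp (-1 : ℤ) ∧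
      v.valuation ℚ (C • W).a₆ = exp (-1 : ℤ) ∧ v.valuation ℚ (C • W).Δ = exp (-4 : ℤ) ∧
      (v.valuation ℚ (C • W).b₈ ≤ exp (-3 : ℤ) ∨ v.valuation ℚ (C • W).b₈ = exp (-2 : ℤ)) := by
  have h2 := Rat.valuation_two_of_two_mem hv
  have h2irr := irreducible_two_adicCompletionIntegers v h2
  have hT' := hT
  rw [kodairaSymbolAt_def] at hT'
  have hΔ4 : (IsDiscreteValuationRing.addVal (v.adicCompletionIntegers ℚ)
      (W.localMinimalIntegralModel v).Δ).toNat = 4 := by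
    rw [← hord, ordMinimalDiscriminant]
  obtain ⟨D, ha₁, ⟨γ, hγ, ha₃⟩, ha₄, ⟨r, hr, ha₆⟩, hb₈, hΔ⟩ :=
    LocalIndex.exists_smul_a_of_kodairaSymbolOfMinimal_eq_II_of_two_of_addVal_eq_four h2irr _ hT' hΔ4
  have ha₂ : (2 : v.adicCompletionIntegers ℚ) ^ 0 ∣ (D • W.localMinimalIntegralModel v).a₂ :=
    ⟨_, (one_mul _).symm⟩
  have hb₈2 : (2 : v.adicCompletionIntegers ℚ) ^ 2 ∣ (D • W.localMinimalIntegralModel v).b₈ := by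
    rcases hb₈ with ⟨w, hw⟩ | ⟨w, -, hw⟩
    · exact ⟨2 * w, by rw [hw]; ring⟩
    · exact ⟨w, hw⟩
  rcases hb₈ with hb₈ | ⟨w, hw, hb₈⟩
  · obtain ⟨-, C, h₁, h₂', h₃, h₄, h₆, h₈, -, hΔ'⟩ := W.exists_variableChange_valuation_a_b₈_of_two v h2
      (k₁ := 1) (k₂ := 0) (k₃ := 1) (k₄ := 1) (k₆ := 1) (k₈ := 3) (n := 4) D
      (by simpa using ha₁) ha₂ ⟨γ, hγ, by simpa using ha₃⟩ (by simpa using ha₄)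
      ⟨r, hr, by simpa using ha₆⟩ hb₈ hΔ
    exact ⟨C, by simpa using h₁, by simpa using h₂', by simpa using h₃, by simpa using h₄,
      by simpa using h₆, by simpa using hΔ', Or.inl (by simpa using h₈)⟩
  · obtain ⟨-, C, h₁, h₂', h₃, h₄, h₆, -, h₈, hΔ'⟩ := W.exists_variableChange_valuation_a_b₈_of_two v h2
      (k₁ := 1) (k₂ := 0) (k₃ := 1) (k₄ := 1) (k₆ := 1) (k₈ := 2) (n := 4) D
      (by simpa using ha₁) ha₂ ⟨γ, hγ, by simpa using ha₃⟩ (by simpa using ha₄)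
      ⟨r, hr, by simpa using ha₆⟩ hb₈2 hΔ
    exact ⟨C, by simpa using h₁, by simpa using h₂', by simpa using h₃, by simpa using h₄,
      by simpa using h₆, by simpa using hΔ', Or.inr (by simpa using h₈ hw hb₈)⟩

/-- **The twist by `-1` of a `C₆`-curve of type `II`, `ord₂ Δ_min = 4`, is potentially good over
`ℚ(∛2)`**: for `W/ℚ` with a `ℚ`-model `C • W` as in
`exists_variableChange_quadraticTwist_neg_one_of_II_four_of_valuation_b₈_le` (`ord₂(b₈) ≥ 3`),
`W^{(-1)}` has good reduction at the places above `v` of every number field `L ∋ β`, `β³ = 2`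
(`(C • W)^{(-1)} ≅ W^{(-1)}` over `ℚ`, `quadraticTwist_smul`; the type-`IV` shape of
`(C • W)^{(-1)}`; `hasGoodReductionAt_baseChange_of_pow_three_eq`).
[cite: SilvermanATAEC1994, IV.9.4 Steps 3–5; proof of Thm. IV.10.2(b) (PDF pp. 359–361)]
[cite: SilvermanAEC2009, VII.5 Prop. 5.4, X.5 Cor. 5.4] -/
theorem hasGoodReductionAt_baseChange_quadraticTwist_neg_one_of_II_four_of_valuation_b₈_le
    {v : HeightOneSpectrum (𝓞 ℚ)} (hv : (2 : 𝓞 ℚ) ∈ v.asIdeal) (C : VariableChange ℚ)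
    (h₁ : v.valuation ℚ (C • W).a₁ ≤ exp (-1 : ℤ)) (h₂ : v.valuation ℚ (C • W).a₂ ≤ 1)
    (h₃ : v.valuation ℚ (C • W).a₃ = exp (-1 : ℤ)) (h₄ : v.valuation ℚ (C • W).a₄ ≤ exp (-1 : ℤ))
    (h₆ : v.valuation ℚ (C • W).a₆ = exp (-1 : ℤ)) (h₈ : v.valuation ℚ (C • W).b₈ ≤ exp (-3 : ℤ))
    (hΔ : v.valuation ℚ (C • W).Δ = exp (-4 : ℤ))
    (L : Type*) [Field L] [NumberField L] [Algebra ℚ L] {β : L} (hβ : β ^ 3 = 2)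
    {w : HeightOneSpectrum (𝓞 L)} (hw : w.asIdeal.under (𝓞 ℚ) = v.asIdeal) :
    ((W.quadraticTwist (-1)).baseChange L).HasGoodReductionAt w := by
  obtain ⟨C', g₁, g₂, g₃, g₄, g₆, gΔ⟩ :=
    (C • W).exists_variableChange_quadraticTwist_neg_one_of_II_four_of_valuation_b₈_le hv h₁ h₂ h₃ h₄
      h₆ h₈ hΔ
  have htw : (C • W).quadraticTwist (-1) =
      (⟨C.u, (-1) * C.r, 0, 0⟩ : VariableChange ℚ) • W.quadraticTwist (-1) :=
    quadraticTwist_smul W C (-1)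
  rw [htw, ← mul_smul] at g₁ g₂ g₃ g₄ g₆ gΔ
  have hβ' : β ^ 3 = algebraMap ℚ L 2 := by rw [hβ, map_ofNat]
  exact (W.quadraticTwist (-1)).hasGoodReductionAt_baseChange_of_pow_three_eq L
    (Rat.valuation_two_of_two_mem hv) hβ' 1 _ g₁ g₂ g₃ g₄ g₆ gΔ
    (by norm_num) (by norm_num) (by norm_num) (by norm_num) (by norm_num) (by norm_num) hw

variable (ℓ : ℕ) [Fact ℓ.Prime]

/-- **`Sw_𝔓(V_ℓ E) = 2` for the `C₆`-curves of type `II`, `ord₂ Δ_min = 4`** (`ℓ ≠ 2`, `𝔓 ∣ 2`):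
`E^{(-1)}` is potentially good over `ℚ(∛2)`
(`hasGoodReductionAt_baseChange_quadraticTwist_neg_one_of_II_four_of_valuation_b₈_le`), so
`Sw_𝔓(V_ℓ E) = 2 · (break of ℚ₂(√-1)) = 2`
(`swanConductorAt_rationalTate_eq_two_of_quadraticTwist_of_emod_four_eq_three`).  Silverman,
*ATAEC* IV.9 Table 4.1 (type `II`, `f = 4`, `ord₂ Δ = 4`) with Thm. IV.10.2(b).
[cite: SilvermanATAEC1994, IV.9 Table 4.1, Thm. IV.10.2(b) (PDF pp. 358–361)] [cite: SerreTate1968, §3] -/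
theorem swanConductorAt_rationalTate_eq_two_of_II_four_of_valuation_b₈_le [W.IsElliptic]
    (h : Continuous fun x : absoluteGaloisGroup ℚ × RationalTateModule (geomPoints W) ℓ ↦
      rationalTateRepresentation (absoluteGaloisGroup ℚ) (geomPoints W) ℓ x.1 x.2)
    {v : HeightOneSpectrum (𝓞 ℚ)} (hv : (2 : 𝓞 ℚ) ∈ v.asIdeal) (hℓ : (ℓ : 𝓞 ℚ) ∉ v.asIdeal)
    (C : VariableChange ℚ)
    (h₁ : v.valuation ℚ (C • W).a₁ ≤ exp (-1 : ℤ)) (h₂ : v.valuation ℚ (C • W).a₂ ≤ 1)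
    (h₃ : v.valuation ℚ (C • W).a₃ = exp (-1 : ℤ)) (h₄ : v.valuation ℚ (C • W).a₄ ≤ exp (-1 : ℤ))
    (h₆ : v.valuation ℚ (C • W).a₆ = exp (-1 : ℤ)) (h₈ : v.valuation ℚ (C • W).b₈ ≤ exp (-3 : ℤ))
    (hΔ : v.valuation ℚ (C • W).Δ = exp (-4 : ℤ))
    {𝔓 : Ideal (absIntegers (𝓞 ℚ) ℚ)} (h𝔓 : 𝔓 ∈ v.primesAbove) :
    (rationalTateGaloisRepOf (geomPoints W) ℓ h).swanConductorAt (𝓞 ℚ) 𝔓 = 2 :=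
  W.swanConductorAt_rationalTate_eq_two_of_quadraticTwist_of_emod_four_eq_three ℓ h hv hℓ
    (d := -1) (by decide)
    (fun L _ _ _ β hβ w hw ↦ by
      have := W.hasGoodReductionAt_baseChange_quadraticTwist_neg_one_of_II_four_of_valuation_b₈_le
        hv C h₁ h₂ h₃ h₄ h₆ h₈ hΔ L hβ hw
      simpa using this)
    h𝔓

attribute [local instance] AddSubgroup.torsionBy.zmodModule in
/-- **Ogg's formula at `2` for the `C₆`-curves of type `II`, `ord₂ Δ_min = 4`, `3`-torsion form**
(the shape of the hypothesis `H` of `conductorNatOf_geomPoints_eq_conductorNorm_of_isElliptic_of_potentiallyGood`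
and its siblings): `Sw_𝔓(E[3]) = δ₂(E)`, both sides being `2` (`Sw_𝔓(V₃ E) = Sw_𝔓(E[3])`,
`swanConductorAt_rationalTate_eq_swanConductorAt_torsion`; `δ₂ = ord₂ Δ_min - 2`,
`wildConductorExponent_eq_of_kodairaSymbolAt_wild`).
[cite: SilvermanATAEC1994, §IV.10 Definition of δ(E/K) (PDF p. 358), Thm. IV.11.1 (pp. 365–366), Table 4.1]
[cite: Saito1988, Theorem 1] -/
theorem swanConductorAt_torsion_eq_wildConductorExponent_of_II_four_of_valuation_b₈_le [W.IsElliptic]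
    {v : HeightOneSpectrum (𝓞 ℚ)} (hv : (2 : 𝓞 ℚ) ∈ v.asIdeal) (hT : W.kodairaSymbolAt v = .II)
    (hord : W.ordMinimalDiscriminant v = 4) (C : VariableChange ℚ)
    (h₁ : v.valuation ℚ (C • W).a₁ ≤ exp (-1 : ℤ)) (h₂ : v.valuation ℚ (C • W).a₂ ≤ 1)
    (h₃ : v.valuation ℚ (C • W).a₃ = exp (-1 : ℤ)) (h₄ : v.valuation ℚ (C • W).a₄ ≤ exp (-1 : ℤ))
    (h₆ : v.valuation ℚ (C • W).a₆ = exp (-1 : ℤ)) (h₈ : v.valuation ℚ (C • W).b₈ ≤ exp (-3 : ℤ))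
    (hΔ : v.valuation ℚ (C • W).Δ = exp (-4 : ℤ))
    {𝔓 : Ideal (absIntegers (𝓞 ℚ) ℚ)} (h𝔓 : 𝔓 ∈ v.primesAbove) :
    (W.torsionGaloisRep 3).swanConductorAt (𝓞 ℚ) 𝔓 = (W.wildConductorExponent v : ℝ) := by
  haveI : Fact (Nat.Prime 3) := ⟨Nat.prime_three⟩
  have h3 : ((3 : ℕ) : 𝓞 ℚ) ∉ v.asIdeal := by
    intro h3
    apply (Ideal.ne_top_iff_one v.asIdeal).mp v.isPrime.ne_top
    have := v.asIdeal.sub_mem h3 hv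
    rwa [show ((3 : ℕ) : 𝓞 ℚ) - 2 = 1 by norm_num] at this
  rw [← W.swanConductorAt_rationalTate_eq_swanConductorAt_torsion 3
    (W.continuous_rationalGaloisRepTate_holds 3) h3 h𝔓,
    W.swanConductorAt_rationalTate_eq_two_of_II_four_of_valuation_b₈_le 3 _ hv h3 C h₁ h₂ h₃ h₄ h₆ h₈
      hΔ h𝔓,
    W.wildConductorExponent_eq_of_kodairaSymbolAt_wild v (Or.inl ⟨hT, rfl⟩), hord]
  norm_num

end WeierstrassCurve

end
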